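import Summits.QuantumFields.BalabanUV.T4Continuum.Support.BlockAverageCurrent
import Summits.QuantumFields.BalabanUV.T4Continuum.Support.NE3EnergyShapes

/-!
# TorusGaugeComb — BRICK B1 of the requested lattice lemma `torusSmallFieldGlobalGauge` (INTERFACE REQUEST NE7, route #1 of the NE7 crux,
# stub S7 NODE O): the COMB (complete axial, maximal-tree) GAUGE on the fundamental box of `ℤ⁴` with periodic extension, and the
# telescoping bound `‖U^u(b) − 1‖ ≤ 3(M − 1)·η` on every INTERIOR bond from the plaquette smallness `SmallField U η` alone

Cell `pub-balaban`, rung (B)+1 sub-cell t4, lineage `b2b-balaban-t4-ne7-p1`, generation 25 (CRUX PROVER NE7 #1, ruling e34b3e0c); crux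
skeleton `t4/skeletons/NE7-CRUX-R1.md` v1.7.6 §4 «INTERFACE REQUEST NE7: `torusSmallFieldGlobalGauge`» (HOME/INBOX.md ll.6031–6037), whose only
consumer is landed (`NE7EtaBackgroundGaugeLetter.hletter_of_torusGauge`, p259521).  HONEST FRAMING (page 1): FIXED FINITE T⁴, rung (B)+1; NE7,
NE3 NOT PRINTED in [Balaban1984PropagatorsI]–[Balaban1989LargeFieldII] and NOT PROVED here; continuum YM on T⁴ ⇐ BetaPertH ∧ nine spine estimates
(0/9 proved); BetaPertH ⇐ (D1) ∧ (D4) ∧ CAP+tail; G-an2-4 gates asym, D1 and NE2/3/4; NOT infinite volume, NOT mass gap, NOT Clay.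

THE REQUESTED LEMMA (target of bricks B1–B4): for every period `M ≥ 1` and plaquette radius `η ≥ 0` in the sector `n·M²·η ≤ c₀`, every unitary
`M`-periodic `U : ℤ⁴ → U(n)` with `SmallField U η` has a unitary `M`-periodic gauge `u` with `U^u = exp A` bondwise, `‖A_b‖ ≤ C·(M⁻¹ + M·η)`.
THIS BRICK (B1, [folklore] lattice gauge theory — the «maximal tree ∕ complete axial gauge», e.g. Creutz, *Quarks, gluons and lattices* ch. 8;
DeGrand–DeTar ch. 3; here with explicit constants and NO periodicity hypothesis on `U`):
 * §1 `combWord y` (the comb path `0 → natSite y`: `y₀` steps `+e₀`, then `y₁` steps `+e₁`, `y₂` steps `+e₂`, `y₃` steps `+e₃`), the transporter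
   `combT U y = U(comb path)` ([Balaban1985Averaging] (9) p. 18, tree `B7Prop1Explicit.hol`), the comb gauge `combGauge U x := combT U (x.toNat)`;
   `combWord_bump` ∕ `combT_bump` (TREE STEP: if `y_j = 0` for `j > μ`, the path to `y + e_μ` is the path to `y` plus one letter), hence
   **`gaugeAct_combGauge_tree`**: every TREE bond (`y_j = 0` for all `j > μ`; in particular every `e₃`-bond) of `U^{T}` is `1`;
   `hol_plaqWord_eq` (the plaquette word unfolded).
 * §2 `norm_inv_mul_sub_one_le` (`‖P⁻¹W − 1‖ ≤ ‖W − 1‖ + ‖P − 1‖` for unitary `P`), **`key_step`** (if the two `ν`-bonds of the plaquette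
   `∂p_{μν}(y)` are tree bonds then `‖V(y + e_ν, μ) − 1‖ ≤ ‖V(y, μ) − 1‖ + η` — gauge invariance of `SmallField`, `BlockAverageCurrent.smallField_gaugeAct`),
   **`telescope`** (peel the `ν`-th coordinate: `‖V(y, μ) − 1‖ ≤ ‖V(y|_{y_ν := 0}, μ) − 1‖ + y_ν·η` for `μ < ν`, vanishing coordinates beyond `ν`),
   **`comb_bound`**: `‖V(natSite y, μ) − 1‖ ≤ (y₁ + y₂ + y₃)·η` on the whole nonnegative orthant.
 * §3 `wrapSite`, **`combGaugePer M U`** (the comb transporter to the reduced site — `M`-PERIODIC by construction, unitary for unitary `U`),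
   `gaugeAct_combGaugePer_interior` (on interior bonds of the box the periodic gauge acts as the comb gauge), and the END **`comb_gauge_box`**:
   `u := combGaugePer M U` is unitary, `M`-periodic, and every interior bond `(natSite y, μ)` (`y_i < M`, `y_μ + 1 < M`) of `U^u` is within
   `3(M − 1)·η` of `1`.
WHAT IS DELIBERATELY NOT HERE (bricks B2–B4 of the request): the WRAP bonds `y_μ = M − 1` of `U^u` are the Polyakov holonomies of `U` (conjugated)
— arbitrary elements of `U(n)`, not controlled by plaquettes; their treatment needs a branch of the matrix logarithm on a unitary sector (B2) and
the direction-by-direction holonomy spreading under the sector condition `n·M²·η ≤ c₀` (B3–B4).  HONEST: elementary lattice bookkeeping with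
explicit constants; nothing of Bałaban asserted; nothing of NE3∕NE7 discharged; 0 sorry.
-/

set_option autoImplicit false

open scoped BigOperators Matrix Matrix.Norms.L2Operator
open Finset NormedSpace

namespace Summit.QuantumFields.BalabanUV.T4Continuum.TorusGaugeComb

open Literature.MathematicalPhysics.QuantumFieldTheory.Balaban1983to89
open B7Prop1Explicit B7Prop2Explicit
open T4AveragingDeficitWall hiding Site Plane Plaq Bond
open NE3EnergyShapes (IsUnitarySite IsPeriodicSite)
open AveragingDeficitTransport (mem_U1_of_unitary)
open BlockAverageCurrent (smallField_gaugeAct)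
open AveragingDeficitKDatum (isUnitaryCfg_gaugeAct)

noncomputable section

/-! ## §1 The comb word and the comb transporter on the nonnegative orthant of `ℤ⁴` -/

section Comb

variable {G : Type*} [Group G]

/-- The site of `ℤ⁴` with natural coordinates `y`. [folklore] -/
def natSite (y : Fin 4 → ℕ) : Site 4 := fun i => (y i : ℤ)

/-- `y` with its `μ`-th coordinate increased by one. [folklore] -/
def bump (y : Fin 4 → ℕ) (μ : Fin 4) : Fin 4 → ℕ := Function.update y μ (y μ + 1)

/-- The COMB WORD from the origin to `natSite y`: `y 0` steps `+e₀`, then `y 1` steps `+e₁`, then `y 2` steps `+e₂`, then `y 3` steps `+e₃`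
(the maximal tree of the «complete axial gauge»). [folklore] -/
def combWord (y : Fin 4 → ℕ) : List (Letter 4) :=
  List.replicate (y 0) ((0 : Fin 4), true) ++ List.replicate (y 1) ((1 : Fin 4), true) ++
    List.replicate (y 2) ((2 : Fin 4), true) ++ List.replicate (y 3) ((3 : Fin 4), true)

/-- The comb transporter `T_y = U(comb path 0 → natSite y)`. [folklore] -/
def combT (U : Site 4 → Fin 4 → G) (y : Fin 4 → ℕ) : G := hol U 0 (combWord y)

/-- The (non-periodic) COMB GAUGE on `ℤ⁴`: at a site `x` the comb transporter to the site with coordinates `(x i).toNat` (so on the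
nonnegative orthant, the transporter to `x` itself). [folklore] -/
def combGauge (U : Site 4 → Fin 4 → G) (x : Site 4) : G := combT U fun i => (x i).toNat

/-- `natSite (bump y μ) = natSite y + e_μ`. [folklore] -/
theorem natSite_bump (y : Fin 4 → ℕ) (μ : Fin 4) : natSite (bump y μ) = natSite y + e μ := by
  funext i
  by_cases h : i = μ
  · subst h
    simp [natSite, bump, e]
  · simp [natSite, bump, e, h]

/-- The coordinates of `natSite y` read back. [folklore] -/
theorem toNat_natSite (y : Fin 4 → ℕ) : (fun i => (natSite y i).toNat) = y := by
  funext i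
  simp [natSite]

/-- The comb word ends at `natSite y`. [folklore] -/
theorem disp_combWord (y : Fin 4 → ℕ) : disp (combWord y) = natSite y := by
  funext i
  simp only [combWord, disp_append, disp_replicate, Letter.vec_true, natSite]
  fin_cases i <;> simp [e]

/-- **TREE STEP**: if all coordinates of `y` beyond `μ` vanish, the comb word to `bump y μ` is the comb word to `y` followed by the
letter `+e_μ`. [folklore] -/
theorem combWord_bump {y : Fin 4 → ℕ} {μ : Fin 4} (h : ∀ j : Fin 4, μ < j → y j = 0) :
    combWord (bump y μ) = combWord y ++ [(μ, true)] := by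
  fin_cases μ
  · have h1 : y 1 = 0 := h 1 (by decide)
    have h2 : y 2 = 0 := h 2 (by decide)
    have h3 : y 3 = 0 := h 3 (by decide)
    simp [combWord, bump, h1, h2, h3, List.replicate_succ']
  · have h2 : y 2 = 0 := h 2 (by decide)
    have h3 : y 3 = 0 := h 3 (by decide)
    simp [combWord, bump, h2, h3, List.replicate_succ']
  · have h3 : y 3 = 0 := h 3 (by decide)
    simp [combWord, bump, h3, List.replicate_succ']
  · simp [combWord, bump, List.replicate_succ']

/-- **TREE STEP FOR THE TRANSPORTER**: `T_{bump y μ} = T_y · U(natSite y, μ)` when the coordinates of `y` beyond `μ` vanish. [folklore] -/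
theorem combT_bump (U : Site 4 → Fin 4 → G) {y : Fin 4 → ℕ} {μ : Fin 4} (h : ∀ j : Fin 4, μ < j → y j = 0) :
    combT U (bump y μ) = combT U y * U (natSite y) μ := by
  unfold combT
  rw [combWord_bump h, hol_append, disp_combWord, zero_add]
  simp [stepHol_true]

/-- The comb-gauged bond variable at a site of the orthant, explicitly. [folklore] -/
theorem gaugeAct_combGauge_natSite (U : Site 4 → Fin 4 → G) (y : Fin 4 → ℕ) (μ : Fin 4) :
    gaugeAct (combGauge U) U (natSite y) μ = combT U y * U (natSite y) μ * (combT U (bump y μ))⁻¹ := by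
  simp only [gaugeAct, combGauge, toNat_natSite, ← natSite_bump]

/-- **TREE BONDS ARE TRIVIAL**: if all coordinates of `y` beyond `μ` vanish, the comb-gauged bond `(natSite y, μ)` is `1`. [folklore] -/
theorem gaugeAct_combGauge_tree (U : Site 4 → Fin 4 → G) {y : Fin 4 → ℕ} {μ : Fin 4} (h : ∀ j : Fin 4, μ < j → y j = 0) :
    gaugeAct (combGauge U) U (natSite y) μ = 1 := by
  rw [gaugeAct_combGauge_natSite, combT_bump U h, mul_inv_cancel]

/-- The plaquette holonomy unfolded: `U(∂p_{μν}(x)) = U(x,μ) U(x+e_μ,ν) U(x+e_ν,μ)⁻¹ U(x,ν)⁻¹`. [folklore] -/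
theorem hol_plaqWord_eq (V : Site 4 → Fin 4 → G) (x : Site 4) (μ ν : Fin 4) :
    hol V x (plaqWord μ ν) = V x μ * V (x + e μ) ν * (V (x + e ν) μ)⁻¹ * (V x ν)⁻¹ := by
  rw [show plaqWord μ ν = [((μ, true) : Letter 4), (ν, true), (μ, false), (ν, false)] from rfl]
  simp only [hol_cons, hol_nil, stepHol_true, stepHol_false, Letter.vec_true, Letter.vec_false, mul_one]
  have e2 : x + e μ + e ν - e μ = x + e ν := by abel
  have e3 : x + e μ + e ν + -e μ = x + e ν := by abel
  have e5 : x + e ν - e ν = x := by abel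
  simp only [e2, e3, e5, mul_assoc]

end Comb

/-! ## §2 The telescoping bound in the comb gauge (`U(n)`-valued configurations) -/

section Bound

variable {n : Type*} [Fintype n] [DecidableEq n] [Nonempty n]

/-- For unitary `P` and any unit `W`: `‖P⁻¹·W − 1‖ ≤ ‖W − 1‖ + ‖P − 1‖` (`P⁻¹W − 1 = P⁻¹(W − 1) + P⁻¹(1 − P)`, `‖P⁻¹‖ ≤ 1`). [folklore] -/
theorem norm_inv_mul_sub_one_le {P : (Matrix n n ℂ)ˣ} (hP : P ∈ unitaryUnits (Matrix n n ℂ)) (W : (Matrix n n ℂ)ˣ) :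
    ‖((P⁻¹ * W : (Matrix n n ℂ)ˣ) : Matrix n n ℂ) - 1‖ ≤ ‖(W : Matrix n n ℂ) - 1‖ + ‖(P : Matrix n n ℂ) - 1‖ := by
  have hP1 : ‖((P⁻¹ : (Matrix n n ℂ)ˣ) : Matrix n n ℂ)‖ ≤ 1 := (mem_U1_of_unitary hP).2
  have hsplit : ((P⁻¹ * W : (Matrix n n ℂ)ˣ) : Matrix n n ℂ) - 1
      = ((P⁻¹ : (Matrix n n ℂ)ˣ) : Matrix n n ℂ) * ((W : Matrix n n ℂ) - 1)
        + ((P⁻¹ : (Matrix n n ℂ)ˣ) : Matrix n n ℂ) * (1 - (P : Matrix n n ℂ)) := by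
    rw [Units.val_mul, mul_sub, mul_sub, mul_one, Units.inv_mul]
    abel
  rw [hsplit]
  calc _ ≤ ‖((P⁻¹ : (Matrix n n ℂ)ˣ) : Matrix n n ℂ) * ((W : Matrix n n ℂ) - 1)‖
          + ‖((P⁻¹ : (Matrix n n ℂ)ˣ) : Matrix n n ℂ) * (1 - (P : Matrix n n ℂ))‖ := norm_add_le _ _
    _ ≤ 1 * ‖(W : Matrix n n ℂ) - 1‖ + 1 * ‖1 - (P : Matrix n n ℂ)‖ := by
        gcongr
        · exact (norm_mul_le _ _).trans (mul_le_mul_of_nonneg_right hP1 (norm_nonneg _))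
        · exact (norm_mul_le _ _).trans (mul_le_mul_of_nonneg_right hP1 (norm_nonneg _))
    _ = ‖(W : Matrix n n ℂ) - 1‖ + ‖(P : Matrix n n ℂ) - 1‖ := by rw [one_mul, one_mul, norm_sub_rev (1 : Matrix n n ℂ) (P : Matrix n n ℂ)]

omit [Nonempty n] in
/-- The comb gauge of a unitary configuration is unitary at every site. [folklore] -/
theorem combGauge_unitary {U : Site 4 → Fin 4 → (Matrix n n ℂ)ˣ} (hU : IsUnitaryCfg U) (x : Site 4) :
    combGauge U x ∈ unitaryUnits (Matrix n n ℂ) :=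
  hol_mem_of hU _ _

/-- **KEY STEP**: in the comb gauge `V = U^{T}`, if the two `ν`-bonds `(natSite y, ν)` and `(natSite y + e_μ, ν)` are trivial, the plaquette
`∂p_{μν}(natSite y)` of `V` is `V(y,μ)·V(y+e_ν,μ)⁻¹`, so `‖V(y + e_ν, μ) − 1‖ ≤ ‖V(y, μ) − 1‖ + η` for `SmallField U η`. [folklore] -/
theorem key_step {U : Site 4 → Fin 4 → (Matrix n n ℂ)ˣ} (hU : IsUnitaryCfg U) {η : ℝ} (hS : SmallField U η) {y : Fin 4 → ℕ}
    {μ ν : Fin 4} (hμν : μ ≠ ν) (h1 : gaugeAct (combGauge U) U (natSite y) ν = 1)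
    (h2 : gaugeAct (combGauge U) U (natSite (bump y μ)) ν = 1) :
    ‖((gaugeAct (combGauge U) U (natSite (bump y ν)) μ : (Matrix n n ℂ)ˣ) : Matrix n n ℂ) - 1‖
      ≤ ‖((gaugeAct (combGauge U) U (natSite y) μ : (Matrix n n ℂ)ˣ) : Matrix n n ℂ) - 1‖ + η := by
  set V := gaugeAct (combGauge U) U with hV
  have hSV : SmallField V η := smallField_gaugeAct (combGauge_unitary hU) hS
  have hVu : IsUnitaryCfg V := isUnitaryCfg_gaugeAct (combGauge_unitary hU) hU
  have hplaq := hSV (natSite y) μ ν hμν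
  rw [hol_plaqWord_eq, ← natSite_bump, ← natSite_bump, h1, h2, inv_one, mul_one, mul_one] at hplaq
  -- `P := V(y,μ) V(y+e_ν,μ)⁻¹`, `V(y+e_ν,μ) = P⁻¹ V(y,μ)`
  set A := V (natSite y) μ with hA
  set B := V (natSite (bump y ν)) μ with hB
  have hPu : A * B⁻¹ ∈ unitaryUnits (Matrix n n ℂ) :=
    (unitaryUnits (Matrix n n ℂ)).mul_mem (hVu _ _) ((unitaryUnits (Matrix n n ℂ)).inv_mem (hVu _ _))
  have hBe : B = (A * B⁻¹)⁻¹ * A := by group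
  rw [hBe]
  have h := norm_inv_mul_sub_one_le hPu A
  linarith

/-- **TELESCOPING ALONG ONE DIRECTION**: for `μ < ν` and `y` with vanishing coordinates beyond `ν`,
`‖V(y, μ) − 1‖ ≤ ‖V(y with y_ν := 0, μ) − 1‖ + y_ν·η`. [folklore] -/
theorem telescope {U : Site 4 → Fin 4 → (Matrix n n ℂ)ˣ} (hU : IsUnitaryCfg U) {η : ℝ} (hS : SmallField U η) {μ ν : Fin 4}
    (hμν : μ < ν) : ∀ (t : ℕ) (y : Fin 4 → ℕ), y ν = t → (∀ j : Fin 4, ν < j → y j = 0) →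
      ‖((gaugeAct (combGauge U) U (natSite y) μ : (Matrix n n ℂ)ˣ) : Matrix n n ℂ) - 1‖
        ≤ ‖((gaugeAct (combGauge U) U (natSite (Function.update y ν 0)) μ : (Matrix n n ℂ)ˣ) : Matrix n n ℂ) - 1‖ + (t : ℝ) * η
  | 0, y, hy, _ => by
      have e0 : Function.update y ν 0 = y := by rw [← hy, Function.update_eq_self]
      rw [e0]; simp
  | t + 1, y, hy, hz => by
      -- `y = bump y' ν` with `y' := update y ν t`
      set y' : Fin 4 → ℕ := Function.update y ν t with hy'
      have hyb : y = bump y' ν := by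
        funext i
        by_cases hi : i = ν
        · subst hi; simp [bump, hy', hy]
        · simp [bump, hy', Function.update_of_ne hi]
      have hz' : ∀ j : Fin 4, ν < j → y' j = 0 := fun j hj => by
        rw [hy', Function.update_of_ne (ne_of_gt hj)]; exact hz j hj
      -- the two `ν`-bonds are tree bonds
      have h1 : gaugeAct (combGauge U) U (natSite y') ν = 1 := gaugeAct_combGauge_tree U hz'
      have h2 : gaugeAct (combGauge U) U (natSite (bump y' μ)) ν = 1 :=
        gaugeAct_combGauge_tree U fun j hj => by
          rw [bump, Function.update_of_ne (ne_of_gt (lt_trans hμν hj))]; exact hz' j hj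
      have hk := key_step hU hS (ne_of_lt hμν) h1 h2
      have ih := telescope hU hS hμν t y' (by simp [hy']) hz'
      have eupd : Function.update y' ν 0 = Function.update y ν 0 := by simp [hy']
      have lhs_eq : natSite y = natSite (bump y' ν) := by rw [hyb]
      rw [lhs_eq]
      rw [eupd] at ih
      push_cast
      linarith

/-- **THE COMB-GAUGE BOUND ON THE ORTHANT**: for unitary `U` with `SmallField U η` (`η ≥ 0`), every comb-gauged bond based at `natSite y` satisfies
`‖V(natSite y, μ) − 1‖ ≤ (y 1 + y 2 + y 3)·η` (directions beyond `μ` only are needed; this crude form suffices). [folklore] -/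
theorem comb_bound {U : Site 4 → Fin 4 → (Matrix n n ℂ)ˣ} (hU : IsUnitaryCfg U) {η : ℝ} (hη : 0 ≤ η) (hS : SmallField U η)
    (y : Fin 4 → ℕ) (μ : Fin 4) :
    ‖((gaugeAct (combGauge U) U (natSite y) μ : (Matrix n n ℂ)ˣ) : Matrix n n ℂ) - 1‖ ≤ ((y 1 + y 2 + y 3 : ℕ) : ℝ) * η := by
  -- peel direction 3, then 2, then 1, stopping at the tree bond
  have h3 : ∀ (z : Fin 4 → ℕ) (μ' : Fin 4), μ' < 3 →
      ‖((gaugeAct (combGauge U) U (natSite z) μ' : (Matrix n n ℂ)ˣ) : Matrix n n ℂ) - 1‖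
        ≤ ‖((gaugeAct (combGauge U) U (natSite (Function.update z 3 0)) μ' : (Matrix n n ℂ)ˣ) : Matrix n n ℂ) - 1‖
          + (z 3 : ℝ) * η :=
    fun z μ' hμ' => telescope hU hS hμ' (z 3) z rfl fun j hj => absurd hj (by fin_cases j <;> decide)
  fin_cases μ
  · -- μ = 0: peel 3, 2, 1
    have a := h3 y 0 (by decide)
    set z3 := Function.update y 3 0 with hz3
    have b := telescope hU hS (show (0 : Fin 4) < 2 by decide) (z3 2) z3 rfl
      fun j hj => by fin_cases j <;> simp_all +decide
    set z2 := Function.update z3 2 0 with hz2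
    have c := telescope hU hS (show (0 : Fin 4) < 1 by decide) (z2 1) z2 rfl
      fun j hj => by fin_cases j <;> simp_all +decide
    have d0 : gaugeAct (combGauge U) U (natSite (Function.update z2 1 0)) 0 = 1 :=
      gaugeAct_combGauge_tree U fun j hj => by fin_cases j <;> simp_all +decide
    rw [d0] at c
    have e2 : z3 2 = y 2 := by simp [hz3]
    have e1 : z2 1 = y 1 := by simp [hz2, hz3]
    simp only [Units.val_one, sub_self, norm_zero, zero_add] at c
    rw [e2] at b; rw [e1] at c
    push_cast
    nlinarith [a, b, c, hη, Nat.cast_nonneg (α := ℝ) (y 1), Nat.cast_nonneg (α := ℝ) (y 2), Nat.cast_nonneg (α := ℝ) (y 3)]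
  · -- μ = 1: peel 3, 2
    have a := h3 y 1 (by decide)
    set z3 := Function.update y 3 0 with hz3
    have b := telescope hU hS (show (1 : Fin 4) < 2 by decide) (z3 2) z3 rfl
      fun j hj => by fin_cases j <;> simp_all +decide
    have d0 : gaugeAct (combGauge U) U (natSite (Function.update z3 2 0)) 1 = 1 :=
      gaugeAct_combGauge_tree U fun j hj => by fin_cases j <;> simp_all +decide
    rw [d0] at b
    have e2 : z3 2 = y 2 := by simp [hz3]
    simp only [Units.val_one, sub_self, norm_zero, zero_add] at b
    rw [e2] at b
    push_cast
    nlinarith [a, b, hη, Nat.cast_nonneg (α := ℝ) (y 1), Nat.cast_nonneg (α := ℝ) (y 2), Nat.cast_nonneg (α := ℝ) (y 3)]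
  · -- μ = 2: peel 3
    have a := h3 y 2 (by decide)
    have d0 : gaugeAct (combGauge U) U (natSite (Function.update y 3 0)) 2 = 1 :=
      gaugeAct_combGauge_tree U fun j hj => by fin_cases j <;> simp_all +decide
    rw [d0] at a
    simp only [Units.val_one, sub_self, norm_zero, zero_add] at a
    push_cast
    nlinarith [a, hη, Nat.cast_nonneg (α := ℝ) (y 1), Nat.cast_nonneg (α := ℝ) (y 2), Nat.cast_nonneg (α := ℝ) (y 3)]
  · -- μ = 3: tree bond
    have d0 : gaugeAct (combGauge U) U (natSite y) 3 = 1 :=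
      gaugeAct_combGauge_tree U fun j hj => absurd hj (by fin_cases j <;> decide)
    show ‖((gaugeAct (combGauge U) U (natSite y) 3 : (Matrix n n ℂ)ˣ) : Matrix n n ℂ) - 1‖ ≤ _
    rw [d0]
    simp only [Units.val_one, sub_self, norm_zero]
    positivity

end Bound

/-! ## §3 The PERIODIC comb gauge and the bound on the interior bonds of the fundamental box -/

section Periodic

variable {G : Type*} [Group G]

/-- Coordinatewise reduction into the fundamental box `[0, M)⁴`. [folklore] -/
def wrapSite (M : ℕ) (x : Site 4) : Site 4 := fun i => x i % (M : ℤ)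

/-- **THE PERIODIC COMB GAUGE**: the comb transporter to the reduced site — an `M`-periodic site field. [folklore] -/
def combGaugePer (M : ℕ) (U : Site 4 → Fin 4 → G) (x : Site 4) : G := combGauge U (wrapSite M x)

/-- `wrapSite` is `M`-periodic. [folklore] -/
theorem wrapSite_add_period (M : ℕ) (x : Site 4) (i : Fin 4) : wrapSite M (x + (M : ℤ) • e i) = wrapSite M x := by
  funext j
  by_cases h : j = i
  · subst h
    simp [wrapSite, e]
  · simp [wrapSite, e, h]

/-- `wrapSite` fixes the sites of the fundamental box. [folklore] -/
theorem wrapSite_natSite {M : ℕ} {y : Fin 4 → ℕ} (hy : ∀ i, y i < M) : wrapSite M (natSite y) = natSite y := by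
  funext j
  simp only [wrapSite, natSite]
  exact Int.emod_eq_of_lt (by positivity) (by exact_mod_cast hy j)

/-- The periodic comb gauge is `M`-periodic. [folklore] -/
theorem combGaugePer_periodic (M : ℕ) (U : Site 4 → Fin 4 → G) : ∀ (x : Site 4) (i : Fin 4),
    combGaugePer M U (x + (M : ℤ) • e i) = combGaugePer M U x := by
  intro x i
  simp only [combGaugePer, wrapSite_add_period]

/-- On an INTERIOR bond of the fundamental box (`y_i < M` for all `i` and `y_μ + 1 < M`) the periodic comb gauge acts as the comb gauge.
[folklore] -/
theorem gaugeAct_combGaugePer_interior {M : ℕ} (U : Site 4 → Fin 4 → G) {y : Fin 4 → ℕ} {μ : Fin 4} (hy : ∀ i, y i < M)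
    (hμ : y μ + 1 < M) :
    gaugeAct (combGaugePer M U) U (natSite y) μ = gaugeAct (combGauge U) U (natSite y) μ := by
  have hy' : ∀ i, bump y μ i < M := fun i => by
    by_cases h : i = μ
    · subst h; simpa [bump] using hμ
    · simp [bump, h, hy i]
  simp only [gaugeAct, combGaugePer, ← natSite_bump, wrapSite_natSite hy, wrapSite_natSite hy']

end Periodic

section Box

variable {n : Type*} [Fintype n] [DecidableEq n] [Nonempty n]

omit [Nonempty n] in
/-- The periodic comb gauge of a unitary configuration is unitary. [folklore] -/
theorem combGaugePer_unitary (M : ℕ) {U : Site 4 → Fin 4 → (Matrix n n ℂ)ˣ} (hU : IsUnitaryCfg U) :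
    IsUnitarySite (combGaugePer M U) :=
  fun x => combGauge_unitary hU (wrapSite M x)

/-- **BRICK B1 OF THE REQUESTED LATTICE LEMMA `torusSmallFieldGlobalGauge` — THE COMB GAUGE ON THE FUNDAMENTAL BOX.**  For a unitary
configuration `U` on `ℤ⁴` with `SmallField U η` (`η ≥ 0`; NO periodicity of `U` needed here) and any period `M`, the periodic comb gauge
`u := combGaugePer M U` is unitary and `M`-periodic, and EVERY INTERIOR BOND of the fundamental box — `(natSite y, μ)` with `y_i < M` and
`y_μ + 1 < M` — satisfies `‖U^u(natSite y, μ) − 1‖ ≤ 3(M − 1)·η` (tree bonds are `1`; the others telescope through at most `y₁ + y₂ + y₃ ≤ 3(M−1)`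
plaquettes).  The WRAP bonds (`y_μ = M − 1`) carry the Polyakov holonomies and are NOT bounded here (bricks B2–B4: branch of the logarithm,
holonomy spreading). [folklore] -/
theorem comb_gauge_box {U : Site 4 → Fin 4 → (Matrix n n ℂ)ˣ} (hU : IsUnitaryCfg U) {η : ℝ} (hη : 0 ≤ η) (hS : SmallField U η) (M : ℕ) :
    IsUnitarySite (combGaugePer M U) ∧ IsPeriodicSite (combGaugePer M U) (M : ℤ) ∧
      ∀ (y : Fin 4 → ℕ) (μ : Fin 4), (∀ i, y i < M) → y μ + 1 < M →
        ‖((gaugeAct (combGaugePer M U) U (natSite y) μ : (Matrix n n ℂ)ˣ) : Matrix n n ℂ) - 1‖ ≤ 3 * ((M : ℝ) - 1) * η := by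
  refine ⟨combGaugePer_unitary M hU, combGaugePer_periodic M U, fun y μ hy hμ => ?_⟩
  rw [gaugeAct_combGaugePer_interior U hy hμ]
  have hb := comb_bound hU hη hS y μ
  have hyi : ∀ i, (y i : ℝ) ≤ (M : ℝ) - 1 := fun i => by
    have h1 : y i + 1 ≤ M := hy i
    have h2 : ((y i + 1 : ℕ) : ℝ) ≤ (M : ℝ) := by exact_mod_cast h1
    push_cast at h2
    linarith
  calc _ ≤ ((y 1 + y 2 + y 3 : ℕ) : ℝ) * η := hb
    _ ≤ 3 * ((M : ℝ) - 1) * η := by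
        apply mul_le_mul_of_nonneg_right _ hη
        push_cast
        linarith [hyi 1, hyi 2, hyi 3]

end Box

end

end Summit.QuantumFields.BalabanUV.T4Continuum.TorusGaugeComb
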